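import Literature.AnabelianGeometry.SemiGraphs.CoveringGraphPullbackSquareCartesian
import Literature.AnabelianGeometry.SemiGraphs.CovObjOfSemiGraphCovering
import Literature.AnabelianGeometry.SemiGraphs.ZariskiMainTheoremBaseChange
import HarnessLib

/-!
# [SemiAnbd] Prop 4.4 (i), the GRAPH-THEORETIC STEP of its proof, GENUINE at the profinite carriers: the pull-back of the
# Zariski covering `K′ = 𝒢_{S_π} → K` along `ψ : H → K` IS `𝔾_H ×_{𝔾_K} 𝔾′`, and its connected pieces EMBED into `𝔾′` (proof-only)

Mochizuki, *Semi-graphs of anabelioids*, Publ. RIMS **42** (2006), §4 Prop 4.4 (i) p. 54 («there exists a finite étale covering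
`K′ → K` of `K` such that the induced morphism `H′ → K′` from any connected component `H′` of the pull-back of this finite étale
covering to `H` is an embedding»), proof p. 55 («Since `K` is quasi-coherent, it follows from Proposition 2.5, (i), that we may
reduce immediately to the case where the given morphism `H → K` is locally trivial.  Thus, we are reduced to a problem in graph
theory — a problem solved in §1 — cf. Theorem 1.2 [i.e., “Zariski's main theorem for semi-graphs”]»), Thm 1.2 (ii) p. 15,
Rmk 3.5.1 p. 37 (kurims `paper:url-f33ace170ff4`). [cite: MochizukiSemiAnbd2006, Prop 4.4 (i), p. 54]

PROOF-ONLY (cell abc-iut, layer L3, seat abc-iut-f-161 gen 8, row «PROP46⟸PULLBACK+P44i» stage 2 FILE D; no definition, no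
instance, no named fact).  Inputs BY NAME: the fibre square `Hom.covPullbackSnd` (stage 1a, `CoveringGraphPullbackSquare(Cartesian)`),
the covering object `CovObj.ofSemiGraphCovering π` of a graph-covering with `𝔾′ ≅ 𝔾_{S_π}` (FILE C′), abc-iut-L3-t1's pull-back of
semi-graphs `SemiGraph.pullback` and THE TREE'S THEOREM Thm 1.2 (ii) `SemiGraph.zariskiMainTheorem_baseChange_holds`.  For
`ψ : Hom H K` (profinite presentations), any family of conjugating elements `θ`, and `π : 𝔾′ → 𝔾_K` a PROPER excision from a semi-graph with
countable fibres, `S := ofSemiGraphCovering π`, `S′ := (ψ.covPullbackWith θ).obj S`: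
* §1 `covPullbackWith_ofSemiGraphCovering_isLocallyTrivial` — `S′` is locally trivial (a pulled-back trivial action is trivial), so
  its orbits are points (`out_cl_covPullbackWith_ofSemiGraphCovering_SV/SE`);
* §2 **`pullbackLift`** (t3's point lift of the tautological points `(w, v′) ↦ ⟨v′⟩` over `pullback.fst`) is a morphism
  `𝔾_H ×_{𝔾_K} 𝔾′ → 𝔾_{S′}` OVER `𝔾_H`, BIJECTIVE on vertices and on edges (`pullbackLift_vertexMap_bijective` / `_edgeMap_…`)
  — «the connected components of the pull-back» of print ARE the connected pieces of the pull-back semi-graph — and COMPATIBLE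
  WITH THE SECOND PROJECTIONS: `pullbackLift ≫ (covPullbackSnd).base` and `pullback.snd ≫ (𝔾′ ≅ 𝔾_{S_π})` agree on vertices and
  edges (`pullbackLift_covPullbackSnd_vertexMap` / `_edgeMap`);
* §3 **`prop44i_graphStep`** — for `ψ` with FINITE `𝔾_H`, `𝔾_K` and IMMERSIVE base: there are a finite semi-graph `𝔾′` and a
  finite graph-covering `π : 𝔾′ → 𝔾_K` such that, with `S`, `S′` as above (so `S` FINITE and locally trivial and `S′`
  locally trivial), EVERY CONNECTED sub-semi-graph `C` of `𝔾_H ×_{𝔾_K} 𝔾′` EMBEDS into `𝔾′` by `C ↪ 𝔾_H ×_{𝔾_K} 𝔾′ → 𝔾′` —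
  Thm 1.2 (ii) read through §§1–2: print's «reduced to a problem in graph theory … Theorem 1.2».
WHAT IS NOT CLAIMED (displayed honestly): (a) print's FIRST reduction «by Prop 2.5 (i) … to the case where `H → K` is locally
trivial» (a finite `S₀ ∈ B^cov(K)` making the pulled-back arrow locally trivial on components) — the constituent half of
«embedding» (Def 4.1 (ii)) therefore holds here exactly when `ψ` is locally trivial (stage 1a's `covPullbackSnd_isLocallyTrivial`);
(b) the `Loc(𝔾, Γ)` / `SgA` dressing of `𝒢_{S′}` and of the two projections (stage 1b).  Nothing printed beyond Thm 1.2 (ii)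
(a tree theorem) is used; no side taken on [IUTchIII] Cor. 3.12.
-/

noncomputable section

namespace Literature.AnabelianGeometry.SemiGraphs

open CategoryTheory
open Literature.AlgebraicGeometry.Frobenioids.QuasiTemperoid.BTempConnected (hom_ρ ρ_one_apply
  ρ_mul_apply ρ_inv_apply)

universe u

namespace ProfiniteSemiGraph

namespace Hom

variable {H K : ProfiniteSemiGraph.{u}} (ψ : Hom H K) (θ : ψ.ConjugatorFamily) {B' : SemiGraph.{u}}
  (π : B' ⟶ K.graph) (hπ : SemiGraph.IsExcision π) (hB' : SemiGraph.IsProper π)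
  [∀ v, Countable (SemiGraph.Hom.VertexFiber π v)] [∀ e, Countable (SemiGraph.Hom.EdgeFiber π e)]

/-! ## §1. The pull-back of `S_π` is locally trivial -/

/-- `ψ^* S_π` is locally trivial: a pulled-back trivial action is trivial. [cite: MochizukiSemiAnbd2006, Rmk 3.5.1 p.37] -/
theorem covPullbackWith_ofSemiGraphCovering_isLocallyTrivial :
    ((ψ.covPullbackWith θ).obj (CovObj.ofSemiGraphCovering π hπ hB')).IsLocallyTrivial :=
  ⟨fun _ _ _ => rfl, fun _ _ _ => rfl⟩

/-- Orbits of `(ψ^* S_π)_w` are points: the chosen representative of the class of `x` is `x`.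
[cite: MochizukiSemiAnbd2006, §2 p.23] -/
theorem out_cl_covPullbackWith_ofSemiGraphCovering_SV (w : H.graph.Vertex)
    (x : (((ψ.covPullbackWith θ).obj (CovObj.ofSemiGraphCovering π hπ hB')).SV w).obj.V) :
    Quot.out (BTemp.cl (((ψ.covPullbackWith θ).obj (CovObj.ofSemiGraphCovering π hπ hB')).SV w) x) = x := by
  obtain ⟨g, hg⟩ := (BTemp.cl_eq_cl_iff _ _ _).mp
    (Quot.out_eq (BTemp.cl (((ψ.covPullbackWith θ).obj (CovObj.ofSemiGraphCovering π hπ hB')).SV w) x))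
  exact hg

/-- … and over edges. [cite: MochizukiSemiAnbd2006, §2 p.23] -/
theorem out_cl_covPullbackWith_ofSemiGraphCovering_SE (e' : H.graph.Edge)
    (x : (((ψ.covPullbackWith θ).obj (CovObj.ofSemiGraphCovering π hπ hB')).SE e').obj.V) :
    Quot.out (BTemp.cl (((ψ.covPullbackWith θ).obj (CovObj.ofSemiGraphCovering π hπ hB')).SE e') x) = x := by
  obtain ⟨g, hg⟩ := (BTemp.cl_eq_cl_iff _ _ _).mp
    (Quot.out_eq (BTemp.cl (((ψ.covPullbackWith θ).obj (CovObj.ofSemiGraphCovering π hπ hB')).SE e') x))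
  exact hg

/-- Two points of `(ψ^* S_π)_w` with the same orbit are equal. [cite: MochizukiSemiAnbd2006, §2 p.23] -/
theorem eq_of_cl_eq_covPullbackWith_ofSemiGraphCovering_SV (w : H.graph.Vertex)
    {x x' : (((ψ.covPullbackWith θ).obj (CovObj.ofSemiGraphCovering π hπ hB')).SV w).obj.V}
    (h : BTemp.cl (((ψ.covPullbackWith θ).obj (CovObj.ofSemiGraphCovering π hπ hB')).SV w) x =
      BTemp.cl (((ψ.covPullbackWith θ).obj (CovObj.ofSemiGraphCovering π hπ hB')).SV w) x') : x = x' := by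
  obtain ⟨g, hg⟩ := (BTemp.cl_eq_cl_iff _ _ _).mp h
  exact hg

/-- … and over edges. [cite: MochizukiSemiAnbd2006, §2 p.23] -/
theorem eq_of_cl_eq_covPullbackWith_ofSemiGraphCovering_SE (e' : H.graph.Edge)
    {x x' : (((ψ.covPullbackWith θ).obj (CovObj.ofSemiGraphCovering π hπ hB')).SE e').obj.V}
    (h : BTemp.cl (((ψ.covPullbackWith θ).obj (CovObj.ofSemiGraphCovering π hπ hB')).SE e') x =
      BTemp.cl (((ψ.covPullbackWith θ).obj (CovObj.ofSemiGraphCovering π hπ hB')).SE e') x') : x = x' := by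
  obtain ⟨g, hg⟩ := (BTemp.cl_eq_cl_iff _ _ _).mp h
  exact hg

/-! ## §2. `𝔾_H ×_{𝔾_K} 𝔾′ → 𝔾_{ψ^* S_π}`: bijective on vertices and edges, over `𝔾_H`, compatible with the projections -/

/-- **Gluing condition** for the tautological points `(w, v′) ↦ ⟨v′⟩ ∈ π⁻¹(ψ w) = (ψ^*S_π)_w` of the pull-back semi-graph over
`pullback.fst`: along a branch `(b₁, b₂)` abutting to `(w, v′)` the gluing of `ψ^* S_π` (that of `S_π` followed by the
trivially acting `θ`) carries `⟨e(b₂)⟩` to `⟨v′⟩` — the branch of `e(b₂)` over `π b₂` is `b₂`, which abuts to `v′`.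
[cite: MochizukiSemiAnbd2006, Def 3.5(i) p.37] -/
theorem pullback_glueCondition :
    ((ψ.covPullbackWith θ).obj (CovObj.ofSemiGraphCovering π hπ hB')).GlueCondition (SemiGraph.pullback.fst ψ.base π)
      (fun ν => (⟨ν.1.2, ν.2.symm⟩ : SemiGraph.Hom.VertexFiber π (ψ.base.vertexMap ν.1.1)))
      (fun ε => (⟨ε.1.2, ε.2.symm⟩ : SemiGraph.Hom.EdgeFiber π (ψ.base.edgeMap ε.1.1))) := by
  refine ⟨fun β ν h => ?_⟩
  have hB : B'.abuts β.1.2 = some ν.1.2 := (SemiGraph.pullback.snd ψ.base π).abuts_branchMap β ν h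
  congr 1
  rw [covPullbackWith_glue_apply,
    (CovObj.ofSemiGraphCovering π hπ hB').eqRec_eq_castPtE
      (ψ.base.edgeOf_branchMap ((SemiGraph.pullback.fst ψ.base π).branchMap β))]
  -- `θ` acts trivially on the fibre of `S_π`
  change ((CovObj.ofSemiGraphCovering π hπ hB').glue _ _ _).hom.hom.hom _ = _
  rw [CovObj.ofSemiGraphCovering_glue_apply]
  apply Subtype.ext
  rw [SemiGraph.Hom.fiberEquivOfBranchOfProper_symm_apply_val]
  -- the transported point is the edge `e(b₂)` of `𝔾′`
  have hval : ∀ {e₁ e₂ : H.graph.Edge} (h₁ : e₁ = e₂) {e₃ : K.graph.Edge} (h₂ : ψ.base.edgeMap e₂ = e₃)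
      (t : (((ψ.covPullbackWith θ).obj (CovObj.ofSemiGraphCovering π hπ hB')).SE e₁).obj.V),
      ((CovObj.ofSemiGraphCovering π hπ hB').castPtE h₂
        (((ψ.covPullbackWith θ).obj (CovObj.ofSemiGraphCovering π hπ hB')).castPtE h₁ t)).1 = t.1 := by
    intro e₁ e₂ h₁ e₃ h₂ t
    subst h₁; subst h₂; rfl
  have key : ∀ (b : K.graph.Branch) (hbb : b = π.branchMap β.1.2) (v : K.graph.Vertex) (hv : K.graph.abuts b = some v)
      (x : SemiGraph.Hom.EdgeFiber π (K.graph.edgeOf b)), x.1 = B'.edgeOf β.1.2 →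
        SemiGraph.Hom.vertexOverOfProper hB' b v hv x = ν.1.2 := by
    intro b hbb v hv x hx
    subst hbb
    exact SemiGraph.Hom.vertexOverOfProper_eq_of_abuts hB' β.1.2 ν.1.2 hB v hv x hx
  exact key _ β.2 _ _ _ (by rw [hval]; rfl)

/-- **`𝔾_H ×_{𝔾_K} 𝔾′ → 𝔾_{ψ^* S_π}` is BIJECTIVE ON VERTICES**: `(w, v′) ↦ (w, [⟨v′⟩])`, orbits of `(ψ^*S_π)_w` being points
— print's «connected components of the pull-back» are the connected pieces of the pull-back semi-graph.
[cite: MochizukiSemiAnbd2006, Prop 4.4 (i), p. 54] -/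
theorem pullbackLift_vertexMap_bijective :
    Function.Bijective (((ψ.covPullbackWith θ).obj (CovObj.ofSemiGraphCovering π hπ hB')).pointLift
      (SemiGraph.pullback.fst ψ.base π) _ _ (ψ.pullback_glueCondition θ π hπ hB')).vertexMap := by
  constructor
  · intro ν₁ ν₂ h
    rw [CovObj.pointLift_vertexMap, CovObj.pointLift_vertexMap] at h
    have h1 : ν₁.1.1 = ν₂.1.1 := congrArg Sigma.fst h
    have h2 := congrArg (fun μ : ((ψ.covPullbackWith θ).obj (CovObj.ofSemiGraphCovering π hπ hB')).coveringSemiGraph.Vertex =>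
      (Quot.out μ.2).1) h
    simp only [out_cl_covPullbackWith_ofSemiGraphCovering_SV] at h2
    exact Subtype.ext (Prod.ext h1 h2)
  · rintro ⟨w, o⟩
    induction o using Quot.ind with
    | mk t =>
      obtain ⟨v', hv'⟩ := t
      exact ⟨⟨(w, v'), hv'.symm⟩, rfl⟩

/-- … and BIJECTIVE ON EDGES. [cite: MochizukiSemiAnbd2006, Prop 4.4 (i), p. 54] -/
theorem pullbackLift_edgeMap_bijective :
    Function.Bijective (((ψ.covPullbackWith θ).obj (CovObj.ofSemiGraphCovering π hπ hB')).pointLift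
      (SemiGraph.pullback.fst ψ.base π) _ _ (ψ.pullback_glueCondition θ π hπ hB')).edgeMap := by
  constructor
  · intro ε₁ ε₂ h
    rw [CovObj.pointLift_edgeMap, CovObj.pointLift_edgeMap] at h
    have h1 : ε₁.1.1 = ε₂.1.1 := congrArg Sigma.fst h
    have h2 := congrArg (fun μ : ((ψ.covPullbackWith θ).obj (CovObj.ofSemiGraphCovering π hπ hB')).coveringSemiGraph.Edge =>
      (Quot.out μ.2).1) h
    simp only [out_cl_covPullbackWith_ofSemiGraphCovering_SE] at h2
    exact Subtype.ext (Prod.ext h1 h2)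
  · rintro ⟨e', o⟩
    induction o using Quot.ind with
    | mk t =>
      obtain ⟨e'', he⟩ := t
      exact ⟨⟨(e', e''), he.symm⟩, rfl⟩

/-- **The lift lies OVER `𝔾_H`**: composed with `𝔾_{ψ^*S_π} → 𝔾_H` it is the first projection of the pull-back.
[cite: MochizukiSemiAnbd2006, §1 p.14] -/
theorem pullbackLift_comp_base :
    ((ψ.covPullbackWith θ).obj (CovObj.ofSemiGraphCovering π hπ hB')).pointLift (SemiGraph.pullback.fst ψ.base π) _ _
        (ψ.pullback_glueCondition θ π hπ hB') ≫
      (show ((ψ.covPullbackWith θ).obj (CovObj.ofSemiGraphCovering π hπ hB')).coveringGraph.graph ⟶ H.graph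
        from ((ψ.covPullbackWith θ).obj (CovObj.ofSemiGraphCovering π hπ hB')).coveringHom.base) =
      SemiGraph.pullback.fst ψ.base π :=
  CovObj.pointLift_comp_base _ _ _ _ _

omit [∀ v, Countable (SemiGraph.Hom.VertexFiber π v)] [∀ e, Countable (SemiGraph.Hom.EdgeFiber π e)] in
/-- Transport of a vertex of a covering semi-graph along an equality of base vertices (bookkeeping for the compatibility
below, whose two sides live over `ψ w` and `π v′`). [cite: MochizukiSemiAnbd2006, §2 p.23] -/
theorem coveringVertex_ext (T : CovObj K) {v v' : K.graph.Vertex} (h : v = v') (x : (T.SV v).obj.V) (x' : (T.SV v').obj.V)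
    (hx : HEq x x') : (⟨v, BTemp.cl (T.SV v) x⟩ : T.coveringSemiGraph.Vertex) = ⟨v', BTemp.cl (T.SV v') x'⟩ := by
  subst h
  rw [eq_of_heq hx]

omit [∀ v, Countable (SemiGraph.Hom.VertexFiber π v)] [∀ e, Countable (SemiGraph.Hom.EdgeFiber π e)] in
/-- … and of an edge. [cite: MochizukiSemiAnbd2006, §2 p.23] -/
theorem coveringEdge_ext (T : CovObj K) {e e' : K.graph.Edge} (h : e = e') (x : (T.SE e).obj.V) (x' : (T.SE e').obj.V)
    (hx : HEq x x') : (⟨e, BTemp.cl (T.SE e) x⟩ : T.coveringSemiGraph.Edge) = ⟨e', BTemp.cl (T.SE e') x'⟩ := by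
  subst h
  rw [eq_of_heq hx]

omit [∀ v, Countable (SemiGraph.Hom.VertexFiber π v)] [∀ e, Countable (SemiGraph.Hom.EdgeFiber π e)] in
/-- Points of fibres of `π` over equal base vertices with the same underlying vertex are `HEq`.
[cite: MochizukiSemiAnbd2006, §1 p.14] -/
theorem vertexFiber_heq {v v' : K.graph.Vertex} (h : v = v') (a : SemiGraph.Hom.VertexFiber π v)
    (c : SemiGraph.Hom.VertexFiber π v') (hac : a.1 = c.1) : HEq a c := by
  subst h
  exact heq_of_eq (Subtype.ext hac)

omit [∀ v, Countable (SemiGraph.Hom.VertexFiber π v)] [∀ e, Countable (SemiGraph.Hom.EdgeFiber π e)] in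
/-- … and for edge fibres. [cite: MochizukiSemiAnbd2006, §1 p.14] -/
theorem edgeFiber_heq {e e' : K.graph.Edge} (h : e = e') (a : SemiGraph.Hom.EdgeFiber π e)
    (c : SemiGraph.Hom.EdgeFiber π e') (hac : a.1 = c.1) : HEq a c := by
  subst h
  exact heq_of_eq (Subtype.ext hac)

/-- **Compatibility with the second projections, on vertices**: the lift followed by the second projection of the fibre
square sends `(w, v′)` to the vertex `(π v′, [⟨v′⟩])` of `𝔾_{S_π}` — the image of `v′ = pullback.snd (w, v′)` under
`𝔾′ ≅ 𝔾_{S_π}`. [cite: MochizukiSemiAnbd2006, Prop 4.4 (i), p. 54] -/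
theorem pullbackLift_covPullbackSnd_vertexMap
    (ν : (SemiGraph.pullback ψ.base π).Vertex) :
    (ψ.covPullbackSnd θ (CovObj.ofSemiGraphCovering π hπ hB')).base.vertexMap
        ((((ψ.covPullbackWith θ).obj (CovObj.ofSemiGraphCovering π hπ hB')).pointLift (SemiGraph.pullback.fst ψ.base π) _ _
          (ψ.pullback_glueCondition θ π hπ hB')).vertexMap ν) =
      (CovObj.ofSemiGraphCovering_graphIso π hπ hB').hom.vertexMap ((SemiGraph.pullback.snd ψ.base π).vertexMap ν) := by
  rw [CovObj.pointLift_vertexMap, covPullbackSnd_base_vertexMap, CovObj.ofSemiGraphCovering_graphIso_hom_vertexMap]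
  dsimp only
  refine coveringVertex_ext _ ν.2 _ _ ?_
  exact (heq_of_eq (ψ.out_cl_covPullbackWith_ofSemiGraphCovering_SV θ π hπ hB' _ ⟨ν.1.2, ν.2.symm⟩)).trans
    (vertexFiber_heq π ν.2 _ _ rfl)

/-- **Compatibility with the second projections, on edges.** [cite: MochizukiSemiAnbd2006, Prop 4.4 (i), p. 54] -/
theorem pullbackLift_covPullbackSnd_edgeMap
    (ε : (SemiGraph.pullback ψ.base π).Edge) :
    (ψ.covPullbackSnd θ (CovObj.ofSemiGraphCovering π hπ hB')).base.edgeMap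
        ((((ψ.covPullbackWith θ).obj (CovObj.ofSemiGraphCovering π hπ hB')).pointLift (SemiGraph.pullback.fst ψ.base π) _ _
          (ψ.pullback_glueCondition θ π hπ hB')).edgeMap ε) =
      (CovObj.ofSemiGraphCovering_graphIso π hπ hB').hom.edgeMap ((SemiGraph.pullback.snd ψ.base π).edgeMap ε) := by
  rw [CovObj.pointLift_edgeMap, covPullbackSnd_base_edgeMap, CovObj.ofSemiGraphCovering_graphIso_hom_edgeMap]
  dsimp only
  refine coveringEdge_ext _ ε.2 _ _ ?_
  exact (heq_of_eq (ψ.out_cl_covPullbackWith_ofSemiGraphCovering_SE θ π hπ hB' _ ⟨ε.1.2, ε.2.symm⟩)).trans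
    (edgeFiber_heq π ε.2 _ _ rfl)

end Hom

/-! ## §3. Prop 4.4 (i): the graph-theoretic step (Thm 1.2 (ii)) through the fibre square -/

namespace Hom

variable {H K : ProfiniteSemiGraph.{u}} (ψ : Hom H K) (θ : ψ.ConjugatorFamily)

/-- Finite fibres of a morphism from a finite semi-graph. [cite: MochizukiSemiAnbd2006, §1 p.14] -/
theorem finite_vertexFiber_of_isFinite {B' : SemiGraph.{u}} (π : B' ⟶ K.graph) (hB' : B'.IsFinite)
    (v : K.graph.Vertex) : Finite (SemiGraph.Hom.VertexFiber π v) := by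
  haveI := hB'.finite_vertex
  exact Subtype.finite

/-- … on edges. [cite: MochizukiSemiAnbd2006, §1 p.14] -/
theorem finite_edgeFiber_of_isFinite {B' : SemiGraph.{u}} (π : B' ⟶ K.graph) (hB' : B'.IsFinite)
    (e : K.graph.Edge) : Finite (SemiGraph.Hom.EdgeFiber π e) := by
  haveI := hB'.finite_edge
  exact Subtype.finite

/-- **Prop 4.4 (i) — the GRAPH-THEORETIC STEP, GENUINE at the profinite carriers.**  For `ψ : H → K` with finite underlying
semi-graphs and immersive underlying morphism, there are a FINITE semi-graph `𝔾′` and a finite graph-covering `π : 𝔾′ → 𝔾_K`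
(Thm 1.2 (ii), a theorem of the tree) such that — with `S := S_π ∈ B^cov(K)` finite and locally trivial (`𝔾_{S} ≅ 𝔾′` over
`𝔾_K`, FILE C′) and its pull-back `ψ^* S` locally trivial, whose covering semi-graph is `𝔾_H ×_{𝔾_K} 𝔾′` (§2: bijective point
lift over `𝔾_H`, compatible with the second projections) — EVERY CONNECTED sub-semi-graph of `𝔾_H ×_{𝔾_K} 𝔾′` EMBEDS into `𝔾′`
through the second projection.  Print p.55: «we are reduced to a problem in graph theory … cf. Theorem 1.2»; the preliminary
reduction «by Proposition 2.5, (i) … to the case where `H → K` is locally trivial» is NOT part of this statement (displayed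
scope). [cite: MochizukiSemiAnbd2006, Prop 4.4 (i), p. 54] -/
theorem prop44i_graphStep (hH : H.graph.IsFinite) (hK : K.graph.IsFinite) (hψ : SemiGraph.IsImmersion ψ.base) :
    ∃ (B' : SemiGraph.{u}) (π : B' ⟶ K.graph) (hπ : SemiGraph.IsExcision π) (hp : SemiGraph.IsProper π)
      (_ : ∀ v, Countable (SemiGraph.Hom.VertexFiber π v)) (_ : ∀ e, Countable (SemiGraph.Hom.EdgeFiber π e)),
      B'.IsFinite ∧ SemiGraph.IsFiniteGraphCovering π ∧
      (CovObj.ofSemiGraphCovering π hπ hp).IsFinite ∧ (CovObj.ofSemiGraphCovering π hπ hp).IsLocallyTrivial ∧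
      ((ψ.covPullbackWith θ).obj (CovObj.ofSemiGraphCovering π hπ hp)).IsLocallyTrivial ∧
      Function.Bijective (((ψ.covPullbackWith θ).obj (CovObj.ofSemiGraphCovering π hπ hp)).pointLift
        (SemiGraph.pullback.fst ψ.base π) _ _ (ψ.pullback_glueCondition θ π hπ hp)).vertexMap ∧
      Function.Bijective (((ψ.covPullbackWith θ).obj (CovObj.ofSemiGraphCovering π hπ hp)).pointLift
        (SemiGraph.pullback.fst ψ.base π) _ _ (ψ.pullback_glueCondition θ π hπ hp)).edgeMap ∧
      ∀ C : (SemiGraph.pullback ψ.base π).Subgraph, C.toSemiGraph.IsConnected →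
        SemiGraph.IsEmbedding (C.ι ≫ SemiGraph.pullback.snd ψ.base π) := by
  obtain ⟨B', π, hπ, hemb⟩ := SemiGraph.zariskiMainTheorem_baseChange_holds H.graph K.graph ψ.base hH hK hψ
  haveI hV : ∀ v, Finite (SemiGraph.Hom.VertexFiber π v) := hπ.2.1
  haveI hE : ∀ e, Finite (SemiGraph.Hom.EdgeFiber π e) := hπ.2.2
  haveI : ∀ v, Countable (SemiGraph.Hom.VertexFiber π v) := fun v => inferInstance
  haveI : ∀ e, Countable (SemiGraph.Hom.EdgeFiber π e) := fun e => inferInstance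
  haveI := hK.finite_vertex
  haveI := hK.finite_edge
  have hB'fin : B'.IsFinite :=
    ⟨Finite.of_equiv _ (Equiv.sigmaFiberEquiv π.vertexMap), Finite.of_equiv _ (Equiv.sigmaFiberEquiv π.edgeMap)⟩
  exact ⟨B', π, hπ.1.2, hπ.1.1, inferInstance, inferInstance, hB'fin, hπ,
    CovObj.ofSemiGraphCovering_isFinite π hπ.1.2 hπ.1.1 hV hE,
    CovObj.ofSemiGraphCovering_isLocallyTrivial π hπ.1.2 hπ.1.1,
    ψ.covPullbackWith_ofSemiGraphCovering_isLocallyTrivial θ π hπ.1.2 hπ.1.1,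
    ψ.pullbackLift_vertexMap_bijective θ π hπ.1.2 hπ.1.1, ψ.pullbackLift_edgeMap_bijective θ π hπ.1.2 hπ.1.1, hemb⟩

end Hom

end ProfiniteSemiGraph

end Literature.AnabelianGeometry.SemiGraphs

end
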